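import Summits.QuantumFields.YangMills.Theorems.BalabanUVNodesK0AxTangentSocketOntoOfProp4W
import Summits.QuantumFields.YangMills.Theorems.BalabanUVNodesN07Delta2OfRecordUnique
import Summits.QuantumFields.YangMills.Theorems.BalabanUVNodesN07SchemeTokensOfRecord
import Summits.QuantumFields.YangMills.Theorems.BalabanUVNodesN07HessOpOfRecordPiFlat
import Summits.QuantumFields.YangMills.Theorems.BalabanUVNodesN07QOfRecordFlatOnto
import Summits.QuantumFields.YangMills.Theorems.BalabanUVNodesN07PrintProjectionOfRecord
import Summits.QuantumFields.YangMills.Theorems.BalabanUVNodesN07FrakGOfRecordReality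
import Summits.QuantumFields.YangMills.Theorems.BalabanUVNodesN07SlotCTraceSectors
import HarnessLib

/-!
# NODE O · K0ᴬ — THE FLAT (R-a) ROAD WITH EVERY LETTER OF THE SCHEME OF RECORD CONSTRUCTED: AT `U₀ = 1` THE (3.134) DATUM `Δ⁽²⁾` VANISHES (`Delta2Tok ∧ Delta2SymmTok ↔ Δ2 = 0`,
# ANY `N`), AND THE BINDERS `hposπ`, `hpos♭`, `hQ`, `hpos′` ARE INHABITED BY NAME — the road of ✓p826658 ∕ ✓p826780 displays only the KNIT tokens, (R2), the small radii, the chart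
# letter and the dictionaries

Cell `pub-ymgap`, width seat `pub-ymgap-dag-n07-w3` (g27), INTENT-17 ∕ CLAIM-17.  `--kind proof --supports stmt-QuantumFields-27238 --as helper`; count-neutral.
[15] = [Balaban1985Variational]; [B9] = [Balaban1985BackgroundPropagators].

WHAT.
* §1 (ANY `N`, the record's letters) ★★★ `delta2Tok_one_iff` — AT THE FLAT BACKGROUND def-Y's two `Δ2` tokens HOLD IFF `Δ2 = 0`: [B9] (3.134) reads `⟨A, Δ⁽²⁾A⟩ = −2⟨HC⁽²⁾A, J⟩` and
  the current of the flat background vanishes (`J(1) = 0`, ✓`JOfRecordAtBg_one`), so the quadratic form of `Δ2` is identically zero (`delta2Tok_one_zero`: `0` carries the token;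
  ✓`delta2SymmTok_zero`); by the uniqueness of the datum under the two tokens (g25 ✓`eq_of_delta2Tok_of_delta2SymmTok` — polarization + perfectness of (27)) every `Δ2` carrying
  them at `U₀ = 1` IS `0` (`delta2_eq_zero_of_tok_one`).  So on the flat record scheme the slot-(c) operator is the π-sandwiched BARE Hessian (g25 ✓`hessOpOfRecord128_one_zero`).
* §2 (`N = 2`, level `k + 1`) ★★★★ `rootedReceipts_of_tokens_atScale_recordScheme_flatLetters` — ✓`rootedReceipts_of_tokens_atScale_recordScheme_of_prop4W` with `Δ2 := 0` (§1: no loss),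
  `hposπ := ✓laplaceAOfRecordAt128_one_zero_pos` (g25; [B9] Thm 3.12 at `1` = Thm 3.11 at `1`), `hpos♭ := ✓laplaceAOfRecord_one_flat_pos` (g24; [B9] Thm 3.11 at `1`),
  `hQ := ✓QOfRecord_one_surjective` (g24); and ★★★★ `…_flatLetters_printGreen` — the same at print's `G′ := (Δ_{U₀} + a′·proj_{N(Q′♭)ᗮ})⁻¹` with `hpos′ := ✓covLaplaceSiteOfRecord_add_kerProj_pos`
  and the `G′` row supplied (✓`printGreenOfRecord_starW`, ✓`scalPartW_printGreenOfRecord`).  Binders being proof-irrelevant, a consumer holding other proofs rewrites by `rfl`; the point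
  is NON-VACUITY: the scheme the road speaks of EXISTS with no displayed letter.  DISPLAY after this file: N07's KNIT tokens for the in-the-small scheme `S_t`, (R2) `QuadAnalytic W C₄ a₃`
  ([15] Prop. 4), «`0 < a₃ ≤ ε_C ≤ t₀`», the chart letter `exp ρ₈ ⊆ SU(2)`, (J-crit′)∕(J-cons′), and the numerics `0 < a`, `0 < a′`, `k + 2 ≤ m + K` (general `G′`: plus its two rows).

HONEST LABELS.  Linear algebra at the flat background + by-name packaging of landed theorems; existential, non-uniform constants; NO estimate off the flat background; nothing of [15]
(Thm 1, Prop. 4, 6, 7, 9) is asserted or discharged; K0ᴬ ⟨27238⟩ NOT closed; N07 NOT discharged; R4 is the conditional finite-𝕋⁴ rung `BalabanLadder.UV` only; finite torus, fixed `ε`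
— nothing continuum ∕ OS ∕ Clay.  **The Yang–Mills mass gap is NOT proved by any of this.**  No `sorry`, no `instance ∕ notation`; standard axioms.
-/

set_option autoImplicit false

noncomputable section

open scoped BigOperators Matrix.Norms.L2Operator InnerProductSpace

namespace Summit.QuantumFields.YangMills.Theorems.K0AxTangentSocketOntoFlatLetters

open Literature.MathematicalPhysics.QuantumFieldTheory.Balaban1983to89
open Literature.MathematicalPhysics.QuantumFieldTheory.Balaban1983to89.T4Continuum (T4Family)
open Literature.MathematicalPhysics.QuantumFieldTheory.Balaban1983to89.Node00
open B12GaugeOrbits021 (OrbitRel)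
open B11Prop6Scheme (mapT)
open B13Contraction113 (QuadAnalytic)
open B9Eq311TracePairing (starW tpair)
open B9Eq311L2Pairing (WL2)
open B9Eq3119DeltaPiCarrier (currentCLM)
open B11Eq103H1Complex (BondL2K SiteL2K covLaplaceSiteK greenK funEquiv)
open B11Eq111FrakG (nabla115)
open B11Eq90V0primeCurrent (flat115)
open B11Eq90Transpose (pair27)
open B15DeterminingSets (MSField avgFamily atScale)
open NormedSpace (exp)
open Summit.QuantumFields.YangMills.Theorems.K0RecordFormatNames
open Summit.QuantumFields.YangMills.Theorems.K0AxRootGrad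
open Summit.QuantumFields.YangMills.Theorems.K0AxCtabUniq
open Summit.QuantumFields.YangMills.Theorems.N07TraceSectorDefs (scalPartW)
open Summit.QuantumFields.YangMills.Theorems.N07Delta2OfRecordExists (pair27_currentCLM_eq_tpair)
open Summit.QuantumFields.YangMills.Theorems.N07Delta2OfRecordUnique (eq_of_delta2Tok_of_delta2SymmTok)
open Summit.QuantumFields.YangMills.Theorems.N07Delta2OfRecordTraceSectors (pair27_zero_left)
open Summit.QuantumFields.YangMills.Theorems.N07SchemeTokensOfRecord (delta2SymmTok_zero)
open Summit.QuantumFields.YangMills.Theorems.N07HessOpOfRecordPiFlat (laplaceAOfRecordAt128_one_zero_pos)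
open Summit.QuantumFields.YangMills.Theorems.N07LaplaceAOfRecordFlatPos (laplaceAOfRecord_one_flat_pos)
open Summit.QuantumFields.YangMills.Theorems.N07QOfRecordFlatOnto (QOfRecord_one_surjective)
open Summit.QuantumFields.YangMills.Theorems.N07PrintProjectionOfRecord (covLaplaceSiteOfRecord_add_kerProj_pos)
open Summit.QuantumFields.YangMills.Theorems.N07FrakGOfRecordReality (printGreenOfRecord_starW)
open Summit.QuantumFields.YangMills.Theorems.N07SlotCTraceSectors (scalPartW_printGreenOfRecord)
open Summit.QuantumFields.YangMills.Theorems.K0AxTangentSocketOntoOfProp4W (rootedReceipts_of_tokens_atScale_recordScheme_of_prop4W)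

/-! ## §1  At the flat background the (3.134) datum vanishes (any `N`) -/

section Flat

variable (F : T4Family) (N : ℕ) [NeZero N] (K : ℕ) (k : ℕ) (Ω : ℕ → Set (Site (F.P K) 0)) (U₀ : GaugeField (F.P K) 0 (SU N))
  [Fact (0 < (F.L : ℝ))] [Fact (0 < (F.P K).eta k)] [Fact (0 < c0Rec F K k)] [Fact (∀ c, 0 < wBRec F K k c)]
  (levB : PBond (F.P K) k → ℕ) (a : ℝ)
  (hposb : ∀ x, x ≠ 0 → 0 < RCLike.re ⟪x, laplaceAOfRecord F N k (1 : GaugeField (F.P K) 0 (SU N))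
    (QOfRecord F N k (1 : GaugeField (F.P K) 0 (SU N))) (QflatOfRecord F N k) a x⟫_ℂ)
  (hQ : Function.Surjective (QOfRecord F N k (1 : GaugeField (F.P K) 0 (SU N))))

omit [NeZero N] [Fact (0 < (F.L : ℝ))] [Fact (0 < (F.P K).eta k)] [Fact (0 < c0Rec F K k)] [Fact (∀ c, 0 < wBRec F K k c)] in
/-- Bookkeeping: the bilinear trace pairing of the record kills the zero function on the left. [cite: Balaban1985BackgroundPropagators, (3.11) p.392 (bookkeeping)] -/
theorem tpair_zero_left (v : BondL2K ℂ (F.P K).d (fun _ => (F.P K).sitesPerDir 0) (c0Rec F K k) (WRec N)) :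
    tpair (phiRec N) (tauRec N) (0 : BondL2K ℂ (F.P K).d (fun _ => (F.P K).sitesPerDir 0) (c0Rec F K k) (WRec N)) v = 0 := by
  simp only [B9Eq311TracePairing.tpair_def, WL2.equiv_zero, Pi.zero_apply, map_zero, zero_mul, mul_zero, Finset.sum_const_zero]

omit [NeZero N] [Fact (∀ c, 0 < wBRec F K k c)] in
/-- Bookkeeping: the current reading of the ZERO operator pairs to zero against every field of (115) (✓`pair27_currentCLM_eq_tpair`).
[cite: Balaban1985Variational, (27) p.282; Balaban1985BackgroundPropagators, (3.11) p.392] -/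
theorem pair27_currentCLM_zero (Y Z : Space115Lit F N K k Ω U₀) :
    pair27 (tauRecCLM N) (currentCLM (phiRec N) (pairLevLit F Ω k) (nabla115 ((F.P K).eta k) (unitsOfRecord F N U₀))
      (0 : BondL2K ℂ (F.P K).d (fun _ => (F.P K).sitesPerDir 0) (c0Rec F K k) (WRec N) →ₗ[ℂ]
        BondL2K ℂ (F.P K).d (fun _ => (F.P K).sitesPerDir 0) (c0Rec F K k) (WRec N)) Y) (flat115 Z) = 0 := by
  rw [pair27_currentCLM_eq_tpair, LinearMap.zero_apply, tpair_zero_left, mul_zero]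

/-- ★ **`Δ2 := 0` CARRIES THE (3.134) TOKEN AT THE FLAT BACKGROUND**: both sides of «`⟨A, Δ⁽²⁾A⟩ = −2⟨HC⁽²⁾A, J(1)⟩`» vanish, the right one because `J(1) = 0` (✓`JOfRecordAtBg_one`).
[cite: Balaban1985BackgroundPropagators, (3.134) p.422, (3.127)–(3.128) p.421; Balaban1985Variational, (26)–(28) p.282] -/
theorem delta2Tok_one_zero : Delta2Tok F N K k Ω (1 : GaugeField (F.P K) 0 (SU N)) levB a hposb hQ 0 := by
  intro A
  rw [JOfRecordAtBg_one, pair27_zero_left, mul_zero, pair27_currentCLM_zero]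

/-- ★★ **EVERY `Δ2` CARRYING def-Y's TWO TOKENS AT THE FLAT BACKGROUND IS `0`** (uniqueness of the datum, ✓`eq_of_delta2Tok_of_delta2SymmTok`, against the witness `0` of
`delta2Tok_one_zero` ∕ ✓`delta2SymmTok_zero`). [cite: Balaban1985BackgroundPropagators, (3.134)–(3.135) p.422; Balaban1985Variational, (27) p.282] -/
theorem delta2_eq_zero_of_tok_one
    {Δ2 : BondL2K ℂ (F.P K).d (fun _ => (F.P K).sitesPerDir 0) (c0Rec F K k) (WRec N) →ₗ[ℂ]
      BondL2K ℂ (F.P K).d (fun _ => (F.P K).sitesPerDir 0) (c0Rec F K k) (WRec N)}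
    (hΔ : Delta2Tok F N K k Ω (1 : GaugeField (F.P K) 0 (SU N)) levB a hposb hQ Δ2)
    (hs : Delta2SymmTok F N K k Ω (1 : GaugeField (F.P K) 0 (SU N)) Δ2) : Δ2 = 0 :=
  eq_of_delta2Tok_of_delta2SymmTok F N K k Ω (1 : GaugeField (F.P K) 0 (SU N)) levB a hposb hQ hΔ hs
    (delta2Tok_one_zero F N K k Ω levB a hposb hQ) (delta2SymmTok_zero F N K k Ω (1 : GaugeField (F.P K) 0 (SU N)))

/-- ★★★ **AT THE FLAT BACKGROUND, `Delta2Tok ∧ Delta2SymmTok ↔ Δ2 = 0`** — on the flat record scheme print's `Δ⁽²⁾` of [B9] (3.134) is ABSENT and the slot-(c) operator is the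
π-sandwiched bare Hessian (✓`hessOpOfRecord128_one_zero`). [cite: Balaban1985BackgroundPropagators, (3.134)–(3.135) p.422, (3.119) p.419; Balaban1985Variational, (26)–(28) p.282] -/
theorem delta2Tok_one_iff
    {Δ2 : BondL2K ℂ (F.P K).d (fun _ => (F.P K).sitesPerDir 0) (c0Rec F K k) (WRec N) →ₗ[ℂ]
      BondL2K ℂ (F.P K).d (fun _ => (F.P K).sitesPerDir 0) (c0Rec F K k) (WRec N)} :
    Delta2Tok F N K k Ω (1 : GaugeField (F.P K) 0 (SU N)) levB a hposb hQ Δ2 ∧ Delta2SymmTok F N K k Ω (1 : GaugeField (F.P K) 0 (SU N)) Δ2 ↔ Δ2 = 0 := by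
  refine ⟨fun h => delta2_eq_zero_of_tok_one F N K k Ω levB a hposb hQ h.1 h.2, ?_⟩
  rintro rfl
  exact ⟨delta2Tok_one_zero F N K k Ω levB a hposb hQ, delta2SymmTok_zero F N K k Ω (1 : GaugeField (F.P K) 0 (SU N))⟩

end Flat

/-! ## §2  The flat (R-a) road with every letter of the scheme of record constructed (`N = 2`, level `k + 1`) -/

section Road

variable (F : T4Family) (θ : Stage13Params F 2) (k K : ℕ) [Fact (0 < (F.L : ℝ))] [Fact (0 < (F.P K).eta (k + 1))] [Fact (0 < c0Rec F K (k + 1))]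
  [Fact (∀ c, 0 < wBRec F K (k + 1) c)]
  (Ω : ℕ → Set (Site (F.P K) 0)) (levB : PBond (F.P K) (k + 1) → ℕ) {a : ℝ} (ha : 0 < a)

set_option maxHeartbeats 1600000 in
/-- ★★★★ **THE FLAT (R-a) ROAD, EVERY LETTER OF THE SCHEME CONSTRUCTED (general `G′`)**: ✓`rootedReceipts_of_tokens_atScale_recordScheme_of_prop4W` read at `Δ2 := 0` (§1: the only datum
the tokens allow at `U₀ = 1`), `hposπ := ✓laplaceAOfRecordAt128_one_zero_pos`, `hpos♭ := ✓laplaceAOfRecord_one_flat_pos`, `hQ := ✓QOfRecord_one_surjective`.  DISPLAYED: the KNIT tokens for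
`S_t`, (R2), `0 < a₃ ≤ ε_C ≤ t₀`, the two `G′` rows, the chart letter, (J-crit′)∕(J-cons′); numerics `0 < a`, `k + 2 ≤ m + K`.
[cite: Balaban1985Variational, Prop. 4 (98) p.293, Prop. 6 (115)–(121) p.295, Prop. 9 p.309; Balaban1985BackgroundPropagators, Thm 3.11 p.416, Thm 3.12 p.421, (3.134) p.422, (3.13)–(3.16) p.393] -/
theorem rootedReceipts_of_tokens_atScale_recordScheme_flatLetters (hk2 : k + 2 ≤ (F.P K).m + (F.P K).K) :
    ∃ t₀ > 0, ∀ (Gp : SiteL2K ℂ (F.P K).d (fun _ => (F.P K).sitesPerDir 0) (c0Rec F K (k + 1)) (WRec 2) →ₗ[ℂ]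
        SiteL2K ℂ (F.P K).d (fun _ => (F.P K).sitesPerDir 0) (c0Rec F K (k + 1)) (WRec 2)) (εC C₄ a₃ : ℝ),
      0 ≤ C₄ → 0 < a₃ → a₃ ≤ εC → εC ≤ t₀ →
      QuadAnalytic (WOfRecordAt F 2 K (k + 1) Ω (1 : GaugeField (F.P K) 0 (SU 2)) levB a (laplaceAOfRecord_one_flat_pos F 2 (k + 1) ha)
        (QOfRecord_one_surjective F 2 K (k + 1) (le_trans (Nat.le_succ _) hk2)) εC Gp) C₄ a₃ →
      (∀ s, Gp (starW (phiRec 2) s) = starW (phiRec 2) (Gp s)) → (∀ s, Gp (scalPartW 2 _ s) = scalPartW 2 _ (Gp s)) →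
      (letI := θ.instVβ₁; letI := θ.instVβ₂; ∀ v : θ.Vβ, NormedSpace.exp (θ.ρ8 v) ∈ Matrix.specialUnitaryGroup (Fin 2) ℂ) →
      ∃ t > 0, ∀ (S : BgSchemeOnLit F 2 K (k + 1) Ω 1),
        S = bgSchemeOfRecord F 2 K (k + 1) Ω 1
            {V : GaugeField (F.P K) (k + 1) (SU 2) | ‖frakAOfRecordAtBg128 F 2 K (k + 1) Ω (1 : GaugeField (F.P K) 0 (SU 2)) levB Gp 0 a
              (laplaceAOfRecordAt128_one_zero_pos F 2 (k + 1) ha Gp) (QOfRecord_one_surjective F 2 K (k + 1) (le_trans (Nat.le_succ _) hk2)) V‖ < t}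
            levB Gp 0 a (laplaceAOfRecordAt128_one_zero_pos F 2 (k + 1) ha Gp) (laplaceAOfRecord_one_flat_pos F 2 (k + 1) ha)
            (QOfRecord_one_surjective F 2 K (k + 1) (le_trans (Nat.le_succ _) hk2)) εC
            ‖frakGOfRecordAtBg128 F 2 K (k + 1) Ω (1 : GaugeField (F.P K) 0 (SU 2)) Gp 0 a (laplaceAOfRecordAt128_one_zero_pos F 2 (k + 1) ha Gp)
              (QOfRecord_one_surjective F 2 K (k + 1) (le_trans (Nat.le_succ _) hk2))‖ C₄ a₃ 0 t t →
        ∀ (Kc : GaugeField (F.P K) (k + 1) (SU 2) → Set (Space115Lit F 2 K (k + 1) Ω 1)),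
        (∀ V ∈ S.dom, ∀ A ∈ Kc V, S.chart V A ∈ bgReg F 2 K (k + 1) θ.εbg ∧ Averaging.iter (avOfRecord F 2 K) (k + 1) (S.chart V A) = V) →
        (∀ V ∈ S.dom, ∀ U : GaugeField (F.P K) 0 (SU 2), U ∈ bgReg F 2 K (k + 1) θ.εbg →
          Averaging.iter (avOfRecord F 2 K) (k + 1) U = V → ∃ A ∈ Kc V, OrbitRel (k + 1) (S.chart V A) U) →
        (∀ V ∈ S.dom, ∀ A ∈ Kc V, IsMinOn (wilsonAction4 ∘ S.chart V) (Kc V) A → ‖A‖ ≤ S.ε₄ ∧ mapT (S.𝒢 V) 0 (S.W V) (S.J V) (S.𝔄 V) A = A) →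
        (∀ V ∈ S.dom, S.sol V ∈ Kc V) → (∀ V ∈ S.dom, IsMinOn (wilsonAction4 ∘ S.chart V) (Kc V) (S.sol V)) →
        FlatCritDictionary F k K (msChart F 2 K (k + 1) (atScale (k + 1)) (avgFamily (avOfRecord F 2 K) 1) (1 : GaugeField (F.P K) 0 (SU 2))) →
        FlatConsDictionary F θ k K (msChart F 2 K (k + 1) (atScale (k + 1)) (avgFamily (avOfRecord F 2 K) 1) (1 : GaugeField (F.P K) 0 (SU 2)))
          (fun B => msChart F 2 K (k + 1) (atScale (k + 1)) (avgFamily (avOfRecord F 2 K) 1) (1 : GaugeField (F.P K) 0 (SU 2)) (S.lieExpo (unitField F θ k K B))) →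
        (∀ (a'' : θ.ιβ) (l : RespLabel F k K),
          RootedResponseCriticalModGaugeAt F θ k K a'' l ∧ RootedResponseOrbitAt F θ k K a'' l ∧
            RootedResponseInvCriticalAt F θ k K a'' l ∧ RootedResponseConstraintModGaugeAt F θ k K a'' l) ∧
        letI := θ.instVβ₁; letI := θ.instVβ₂
        ContDiffAt ℝ 2 (fun B : Fin (F.P K).d → Site (F.P K) (k + 1) → θ.Vβ =>
          fun (b : PBond (F.P K) 0) (i i' : Fin 2) => ((recordBgField F θ k K B b : SU 2) : Matrix (Fin 2) (Fin 2) ℂ) i i') 0 := by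
  have hk1 : k + 1 ≤ (F.P K).m + (F.P K).K := le_trans (Nat.le_succ _) hk2
  obtain ⟨t₀, ht₀, hroad⟩ := rootedReceipts_of_tokens_atScale_recordScheme_of_prop4W F θ k K Ω levB a (laplaceAOfRecord_one_flat_pos F 2 (k + 1) ha)
    (QOfRecord_one_surjective F 2 K (k + 1) hk1) hk2
  exact ⟨t₀, ht₀, fun Gp εC C₄ a₃ hC₄ ha₃ ha₃ε hεt hW hGpR hGpS hρ =>
    hroad Gp 0 (laplaceAOfRecordAt128_one_zero_pos F 2 (k + 1) ha Gp) εC C₄ a₃ hC₄ ha₃ ha₃ε hεt hW hGpR hGpS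
      (delta2Tok_one_zero F 2 K (k + 1) Ω levB a _ _) (delta2SymmTok_zero F 2 K (k + 1) Ω (1 : GaugeField (F.P K) 0 (SU 2))) hρ⟩

set_option maxHeartbeats 1600000 in
/-- ★★★★ **THE FLAT (R-a) ROAD WITH PRINT's `G′`, EVERY LETTER CONSTRUCTED**: `G′ := (Δ_{U₀} + a′·proj_{N(Q′♭)ᗮ})⁻¹` with `hpos′ := ✓covLaplaceSiteOfRecord_add_kerProj_pos` (`0 < a′`), its two rows
supplied (✓`printGreenOfRecord_starW`, ✓`scalPartW_printGreenOfRecord`), `Δ2 := 0`, `hposπ`∕`hpos♭`∕`hQ` as above.  DISPLAYED: the KNIT tokens for `S_t`, (R2), `0 < a₃ ≤ ε_C ≤ t₀`, the chart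
letter, (J-crit′)∕(J-cons′); numerics `0 < a`, `0 < a′`, `k + 2 ≤ m + K` — nothing else.
[cite: Balaban1985Variational, Prop. 4 (98) p.293, Prop. 6 (115)–(121) p.295, Prop. 9 p.309; Balaban1985BackgroundPropagators, (3.24)–(3.25) p.394, Thm 3.11 p.416, Thm 3.12 p.421, (3.134) p.422] -/
theorem rootedReceipts_of_tokens_atScale_recordScheme_flatLetters_printGreen {a' : ℝ} (ha' : 0 < a') (hk2 : k + 2 ≤ (F.P K).m + (F.P K).K) :
    haveI : (LinearMap.ker (QflatOfRecord F 2 (K := K) (k + 1))).HasOrthogonalProjection :=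
      haveI : CompleteSpace ↥(LinearMap.ker (QflatOfRecord F 2 (K := K) (k + 1))) := FiniteDimensional.complete ℂ _
      inferInstance
    ∃ t₀ > 0, ∀ (εC C₄ a₃ : ℝ),
      0 ≤ C₄ → 0 < a₃ → a₃ ≤ εC → εC ≤ t₀ →
      QuadAnalytic (WOfRecordAt F 2 K (k + 1) Ω (1 : GaugeField (F.P K) 0 (SU 2)) levB a (laplaceAOfRecord_one_flat_pos F 2 (k + 1) ha)
        (QOfRecord_one_surjective F 2 K (k + 1) (le_trans (Nat.le_succ _) hk2)) εC
        (greenK _ (covLaplaceSiteOfRecord_add_kerProj_pos F 2 (k + 1) (1 : GaugeField (F.P K) 0 (SU 2)) ha'))) C₄ a₃ →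
      (letI := θ.instVβ₁; letI := θ.instVβ₂; ∀ v : θ.Vβ, NormedSpace.exp (θ.ρ8 v) ∈ Matrix.specialUnitaryGroup (Fin 2) ℂ) →
      ∃ t > 0, ∀ (S : BgSchemeOnLit F 2 K (k + 1) Ω 1),
        S = bgSchemeOfRecord F 2 K (k + 1) Ω 1
            {V : GaugeField (F.P K) (k + 1) (SU 2) | ‖frakAOfRecordAtBg128 F 2 K (k + 1) Ω (1 : GaugeField (F.P K) 0 (SU 2)) levB
              (greenK _ (covLaplaceSiteOfRecord_add_kerProj_pos F 2 (k + 1) (1 : GaugeField (F.P K) 0 (SU 2)) ha')) 0 a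
              (laplaceAOfRecordAt128_one_zero_pos F 2 (k + 1) ha _) (QOfRecord_one_surjective F 2 K (k + 1) (le_trans (Nat.le_succ _) hk2)) V‖ < t}
            levB (greenK _ (covLaplaceSiteOfRecord_add_kerProj_pos F 2 (k + 1) (1 : GaugeField (F.P K) 0 (SU 2)) ha')) 0 a
            (laplaceAOfRecordAt128_one_zero_pos F 2 (k + 1) ha _) (laplaceAOfRecord_one_flat_pos F 2 (k + 1) ha)
            (QOfRecord_one_surjective F 2 K (k + 1) (le_trans (Nat.le_succ _) hk2)) εC
            ‖frakGOfRecordAtBg128 F 2 K (k + 1) Ω (1 : GaugeField (F.P K) 0 (SU 2))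
              (greenK _ (covLaplaceSiteOfRecord_add_kerProj_pos F 2 (k + 1) (1 : GaugeField (F.P K) 0 (SU 2)) ha')) 0 a
              (laplaceAOfRecordAt128_one_zero_pos F 2 (k + 1) ha _) (QOfRecord_one_surjective F 2 K (k + 1) (le_trans (Nat.le_succ _) hk2))‖ C₄ a₃ 0 t t →
        ∀ (Kc : GaugeField (F.P K) (k + 1) (SU 2) → Set (Space115Lit F 2 K (k + 1) Ω 1)),
        (∀ V ∈ S.dom, ∀ A ∈ Kc V, S.chart V A ∈ bgReg F 2 K (k + 1) θ.εbg ∧ Averaging.iter (avOfRecord F 2 K) (k + 1) (S.chart V A) = V) →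
        (∀ V ∈ S.dom, ∀ U : GaugeField (F.P K) 0 (SU 2), U ∈ bgReg F 2 K (k + 1) θ.εbg →
          Averaging.iter (avOfRecord F 2 K) (k + 1) U = V → ∃ A ∈ Kc V, OrbitRel (k + 1) (S.chart V A) U) →
        (∀ V ∈ S.dom, ∀ A ∈ Kc V, IsMinOn (wilsonAction4 ∘ S.chart V) (Kc V) A → ‖A‖ ≤ S.ε₄ ∧ mapT (S.𝒢 V) 0 (S.W V) (S.J V) (S.𝔄 V) A = A) →
        (∀ V ∈ S.dom, S.sol V ∈ Kc V) → (∀ V ∈ S.dom, IsMinOn (wilsonAction4 ∘ S.chart V) (Kc V) (S.sol V)) →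
        FlatCritDictionary F k K (msChart F 2 K (k + 1) (atScale (k + 1)) (avgFamily (avOfRecord F 2 K) 1) (1 : GaugeField (F.P K) 0 (SU 2))) →
        FlatConsDictionary F θ k K (msChart F 2 K (k + 1) (atScale (k + 1)) (avgFamily (avOfRecord F 2 K) 1) (1 : GaugeField (F.P K) 0 (SU 2)))
          (fun B => msChart F 2 K (k + 1) (atScale (k + 1)) (avgFamily (avOfRecord F 2 K) 1) (1 : GaugeField (F.P K) 0 (SU 2)) (S.lieExpo (unitField F θ k K B))) →
        (∀ (a'' : θ.ιβ) (l : RespLabel F k K),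
          RootedResponseCriticalModGaugeAt F θ k K a'' l ∧ RootedResponseOrbitAt F θ k K a'' l ∧
            RootedResponseInvCriticalAt F θ k K a'' l ∧ RootedResponseConstraintModGaugeAt F θ k K a'' l) ∧
        letI := θ.instVβ₁; letI := θ.instVβ₂
        ContDiffAt ℝ 2 (fun B : Fin (F.P K).d → Site (F.P K) (k + 1) → θ.Vβ =>
          fun (b : PBond (F.P K) 0) (i i' : Fin 2) => ((recordBgField F θ k K B b : SU 2) : Matrix (Fin 2) (Fin 2) ℂ) i i') 0 := by
  haveI : (LinearMap.ker (QflatOfRecord F 2 (K := K) (k + 1))).HasOrthogonalProjection :=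
    haveI : CompleteSpace ↥(LinearMap.ker (QflatOfRecord F 2 (K := K) (k + 1))) := FiniteDimensional.complete ℂ _
    inferInstance
  have hpos' := covLaplaceSiteOfRecord_add_kerProj_pos F 2 (k + 1) (1 : GaugeField (F.P K) 0 (SU 2)) ha'
  have hGpR := printGreenOfRecord_starW F 2 (k + 1) (1 : GaugeField (F.P K) 0 (SU 2)) a' hpos'
  have hGpS := scalPartW_printGreenOfRecord F 2 (k + 1) (1 : GaugeField (F.P K) 0 (SU 2)) a' hpos'
  obtain ⟨t₀, ht₀, hroad⟩ := rootedReceipts_of_tokens_atScale_recordScheme_flatLetters F θ k K Ω levB ha hk2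
  exact ⟨t₀, ht₀, fun εC C₄ a₃ hC₄ ha₃ ha₃ε hεt hW hρ => hroad (greenK _ hpos') εC C₄ a₃ hC₄ ha₃ ha₃ε hεt hW hGpR hGpS hρ⟩

end Road

end Summit.QuantumFields.YangMills.Theorems.K0AxTangentSocketOntoFlatLetters

end
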